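import Mathlib
import HarnessLib
import Summits.HubbardSuperconductivity.HubbardSuperconductivity.Theorems.KLProgrammeKLRegimeSplitPredicatesV3

/-!
# Route `KLProgramme` — crux K3 ENGINE (stmt-HubbardSuperconductivity-20437 `KLRegimeEngineV17F2`), stub (b) v2, THE LEVELS PACKAGE (ℓ):
# instantiation (I5), THE NUMERICS — the λ-ROW of the kit in the model's regime: `λ = B·ε_j` is ONE U-door plus ONE c-door
# (companion of `…EngineTowerNumerics`; E1-LEVELS-BLUEPRINT-g8 §2 «`ε_j ≤ Klam(|U| + cc/ln 4)` in the regime is the smallness the numerics (I5) use»,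
#  E1-TOWER-BLOCKED §4 (iv); cell gate-hubbard-kl, seat hubbard-kl-k3c3-p2 g13, located «(ℓ)-NUMERICS»)

The kit `towerBorn_le_law_split` / `towerBorn_le_law_tracks` is run once per read-out level with the CONSTANT coupling
`lam := B · epsCoupling P U j` (`epsCoupling P U j = Klam·(|U| + U²·j)`, blueprint §2), and `…EngineTowerNumerics` reduces all its numerical side
conditions to two amplitude rows plus `lam ≤ λ₀` for ONE explicit `λ₀`.  Under the binders of `TowerLevelsStep` / `stub_engine_step_norms`
(`IsKLRegime U cc (−n)`, `j ≤ n`) this file spells the λ-row out: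

* `towerNumerics_epsCoupling_le_of_isKLRegime` — `ε_j ≤ Klam·(|U| + cc/log 4)` for every `j ≤ n` (the regime caps `U²·n`, NOT `U·n`);
* `towerNumerics_lam_le_of_doors` — `B·ε_j ≤ λ₀` from the U-DOOR `2·B·Klam·U ≤ λ₀` and the c-DOOR `2·B·Klam·(cc/log 4) ≤ λ₀`;
  `towerNumerics_uDoor_of_le` — the U-door from the closed form `U ≤ λ₀/(2·B·Klam + 1)` (the shape of (I5)'s `klTowerLevelsU` entry);
* `towerNumerics_lam_pos` — `0 < B·ε_j` (the kit's `hlam`) for `0 < B`, `0 < Klam`, `0 < U`.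

NOTE for (I5)'s instantiation (located, «(ℓ)-C-DOOR»): `TowerLevelsStep P R Q₀ CE u` / `TowerNormsStep` fix the regime constant at
`cc ≤ klEngC₃6 P R` and let the package choose only `(CE, u)`; the U-door is served by `u`, but the c-door is the CONSTANTS inequality
`2·B·Klam·klEngC₃6 P R / log 4 ≤ λ₀(P, R)` between the frozen `klEngC₃6 ≤ klEngC₃3 = 2^{-120}/(klEngPsq·klEngRsq²)` and the tower's threshold —
to be checked once (I1)–(I4) freeze the kit constants; no choice of `u` can replace it (`U²·n` reaches `cc/log 4` at every `U`).
Pure real arithmetic on two landed definitions; nothing about the model is asserted; nothing asserts any stub, (ℓ), K3 or superconductivity.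
References: Benfatto–Giuliani–Mastropietro 2006 §2.8 (2.83), §3 [cite: BenfattoGiulianiMastropietro2006].
-/

noncomputable section

namespace Summit.HubbardSuperconductivity.HubbardSuperconductivity.Theorems.EngineV8

set_option linter.dupNamespace false -- summit = problem name (single-conjunct summit), D-0017

open Real
open Summit.HubbardSuperconductivity.HubbardSuperconductivity.Theorems.KLRegimeSplit
open Summit.HubbardSuperconductivity.HubbardSuperconductivity.Theorems.DispersionFlow

/-- **The regime caps the running coupling**: `IsKLRegime U cc (−n)` and `j ≤ n` give `ε_j = Klam·(|U| + U²·j) ≤ Klam·(|U| + cc/log 4)`. -/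
theorem towerNumerics_epsCoupling_le_of_isKLRegime {P : SplitConsts} (hK : 0 ≤ P.Klam) {U cc : ℝ} {n j : ℕ}
    (hreg : IsKLRegime U cc (-(n : ℤ))) (hj : j ≤ n) :
    epsCoupling P U j ≤ P.Klam * (|U| + cc / Real.log 4) := by
  unfold epsCoupling
  unfold IsKLRegime at hreg
  have habs : |((-(n : ℤ) : ℤ) : ℝ)| = (n : ℝ) := by
    rw [Int.cast_neg, Int.cast_natCast, abs_neg, Nat.abs_cast]
  rw [habs] at hreg
  have hlog : 0 < Real.log 4 := Real.log_pos (by norm_num)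
  have h1 : U ^ 2 * (j : ℝ) ≤ U ^ 2 * n := mul_le_mul_of_nonneg_left (Nat.cast_le.2 hj) (sq_nonneg U)
  have h2 : U ^ 2 * (n : ℝ) ≤ cc / Real.log 4 := by rw [le_div_iff₀ hlog]; exact hreg
  exact mul_le_mul_of_nonneg_left (by linarith) hK

/-- **The λ-row is ONE U-door plus ONE c-door**: `2·B·Klam·U ≤ λ₀` and `2·B·Klam·(cc/log 4) ≤ λ₀` give `B·ε_j ≤ λ₀` for every `j ≤ n` in the
regime (`0 ≤ U`, `0 ≤ B`, `0 ≤ Klam`). -/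
theorem towerNumerics_lam_le_of_doors {P : SplitConsts} (hK : 0 ≤ P.Klam) {U cc B lam₀ : ℝ} (hU : 0 ≤ U) (hB : 0 ≤ B) {n j : ℕ}
    (hreg : IsKLRegime U cc (-(n : ℤ))) (hj : j ≤ n)
    (hUdoor : 2 * B * P.Klam * U ≤ lam₀) (hcdoor : 2 * B * P.Klam * (cc / Real.log 4) ≤ lam₀) :
    B * epsCoupling P U j ≤ lam₀ := by
  have h := towerNumerics_epsCoupling_le_of_isKLRegime hK hreg hj
  rw [abs_of_nonneg hU] at h
  calc B * epsCoupling P U j ≤ B * (P.Klam * (U + cc / Real.log 4)) := mul_le_mul_of_nonneg_left h hB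
    _ = (2 * B * P.Klam * U) / 2 + (2 * B * P.Klam * (cc / Real.log 4)) / 2 := by ring
    _ ≤ lam₀ / 2 + lam₀ / 2 := by gcongr
    _ = lam₀ := by ring

/-- **The U-door from a closed form**: `U ≤ λ₀/(2·B·Klam + 1)` (the shape of a `klTowerLevelsU` entry) gives `2·B·Klam·U ≤ λ₀`. -/
theorem towerNumerics_uDoor_of_le {P : SplitConsts} (hK : 0 ≤ P.Klam) {U B lam₀ : ℝ} (hB : 0 ≤ B) (hlam₀ : 0 ≤ lam₀)
    (hu : U ≤ lam₀ / (2 * B * P.Klam + 1)) : 2 * B * P.Klam * U ≤ lam₀ := by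
  have ha : 0 ≤ 2 * B * P.Klam := by positivity
  have hd : 0 < 2 * B * P.Klam + 1 := by positivity
  calc 2 * B * P.Klam * U ≤ 2 * B * P.Klam * (lam₀ / (2 * B * P.Klam + 1)) := mul_le_mul_of_nonneg_left hu ha
    _ ≤ lam₀ := by
      rw [mul_div_assoc', div_le_iff₀ hd]
      nlinarith

/-- **The c-door from a closed form**: `cc ≤ λ₀·log 4/(2·B·Klam + 1)` gives `2·B·Klam·(cc/log 4) ≤ λ₀` — the inequality (I5) must establish for
the frozen `cc ≤ klEngC₃6 P R` («(ℓ)-C-DOOR»). -/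
theorem towerNumerics_cDoor_of_le {P : SplitConsts} (hK : 0 ≤ P.Klam) {cc B lam₀ : ℝ} (hB : 0 ≤ B) (hlam₀ : 0 ≤ lam₀)
    (hc : cc ≤ lam₀ * Real.log 4 / (2 * B * P.Klam + 1)) : 2 * B * P.Klam * (cc / Real.log 4) ≤ lam₀ := by
  have hlog : 0 < Real.log 4 := Real.log_pos (by norm_num)
  have ha : 0 ≤ 2 * B * P.Klam := by positivity
  have hd : 0 < 2 * B * P.Klam + 1 := by positivity
  have hc' : cc / Real.log 4 ≤ lam₀ / (2 * B * P.Klam + 1) := by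
    rw [div_le_iff₀ hlog]
    calc cc ≤ lam₀ * Real.log 4 / (2 * B * P.Klam + 1) := hc
      _ = lam₀ / (2 * B * P.Klam + 1) * Real.log 4 := by ring
  calc 2 * B * P.Klam * (cc / Real.log 4) ≤ 2 * B * P.Klam * (lam₀ / (2 * B * P.Klam + 1)) := mul_le_mul_of_nonneg_left hc' ha
    _ ≤ lam₀ := by
      rw [mul_div_assoc', div_le_iff₀ hd]
      nlinarith

/-- **The kit's `hlam`**: `0 < B·ε_j` for `0 < B`, `0 < Klam`, `0 < U`. -/
theorem towerNumerics_lam_pos {P : SplitConsts} (hK : 0 < P.Klam) {U B : ℝ} (hU : 0 < U) (hB : 0 < B) (j : ℕ) :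
    0 < B * epsCoupling P U j := by
  unfold epsCoupling
  have : 0 < |U| + U ^ 2 * (j : ℝ) := by positivity
  positivity

end Summit.HubbardSuperconductivity.HubbardSuperconductivity.Theorems.EngineV8

end
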